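import Summits.QuantumFields.YangMills.Theorems.FluctuationComparisonRegPrIntLOrganTangentHaarFactorLipOfDwhite
import Summits.QuantumFields.YangMills.Theorems.FluctuationComparisonRegPrIntLOrganTangentD0ChartLettersWhitened
import HarnessLib

/-!
# Crux `FluctuationComparisonRegPrIntL` (stmt-QuantumFields-20520, rung R3), PATH-B organ (covariant organ of record, RULING №56) — (L53) «(χ∣MW) DOCKING»: ✓(L50b)'s two
# Jacobian letters (χ-bdd) and (χ-Lip∣MW) FROM a READING letter (χ-read) «`χ V z = Π_{e∈S} sinc²‖toE (Wh V z e)‖`» (RULING №57 (i)) + the (Dwhite∣MW) letter itself, over px19 g23's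
# certificate ✓p828570 `haarFactor_mem_Icc` ∕ `haarFactor_lip_of_dwhite`; and the (J-Lip)∣MW binders `hPJ`∕`hSJ` of ✓p823910 END TO END from (Jfac) + (cJ-bdd∕Lip) + (χ-read) + (Dwhite∣MW)

Cell `ym3-torus` (YM ladder rung R3 = continuum `SU(2)` Yang–Mills on the three-torus — a RUNG: NOT d = 4, NOT infinite volume, NOT a mass gap, NOT Clay).
Width seat `ym-ust-20520-w5` (gen 26), `--kind proof --supports stmt-QuantumFields-20520 --as helper`, count-neutral, DEFINITION-FREE, default heartbeats,
no registry ∕ binder ∕ `Lines/` edit.  Over ✓p828570 `…OrganTangentHaarFactorLipOfDwhite` (px19 g23: `haarFactor_mem_Icc`, `haarFactor_lip_of_dwhite` — the RULING №57 (i)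
certificate at the `Finset` level) and ✓p827906 `…OrganTangentD0ChartLettersWhitened` (`jLipPath_of_factors`, `jLipSquare_of_factors`).

THE LETTERS.  (χ-read) «`χ V z = Π_{e∈S} sinc ‖toE (Wh V z e)‖ ^ 2`» for a finite set `S` of unit-lattice bonds — RULING №57 (i): the exponential-chart Haar density `σ∕σ₀ = sinc²|·|`
([Balaban1985UV3] p.260 L25–31) read through the whitened coordinates `Wh V z = K_V^{−1∕2}z` of ✓(L50b)'s (Φw); the z-free constant `(2π²)^{−#S}` sits in `cJ` ((Jfac)).
(Dwhite∣MW) = ✓(L50b)'s `hDwhite` binder text VERBATIM (itself ⟸ ✓(L52) `dwhite_of_whiteningKernel` ⟸ px19's whitening-kernel letters).  (Jfac), (cJ-bdd∕Lip) = ✓(L50b)'s.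
INHABITATION (★★OWNER RULING №100): LAW-FREE — identities∕inequalities about the chart objects `χ`, `Wh` pointwise in `z`; no fibre law, no score, no cross-law object.

WHAT.  §1 ★★`chi_bdd_of_read` — (χ-read) ⟹ ✓(L50b)'s `hχbdd` text with `Cχ := 1` (`haarFactor_mem_Icc`); ★★★`chi_lip_of_read_dwhite` — (χ-read) + (Dwhite∣MW) ⟹ ✓(L50b)'s `hχLip`
text with `Kχ := √3·Σ_{e∈S} kW e` (`haarFactor_lip_of_dwhite` fed with (Dwhite∣MW)'s bondwise increments at `c = ‖u‖`).  §2 ★★★`jLipPath_of_cJ_chiRead_dwhite` ∕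
★★★`jLipSquare_of_cJ_chiRead_dwhite` — ✓p823910's `hPJ` ∕ `hSJ` binder texts with `KJ := toNNReal ((Cc·(√3·Σ kW) + 1·Kc)·(√3·(rc·(θ_j∕4))))` ⟸ (Jfac) + (cJ-bdd∕Lip) + (χ-read) +
(Dwhite∣MW) (= ✓`jLipPath∕Square_of_factors` ∘ §1).  NET: the D0 letter list of REG′ reads {(Φw), (Dmin), (Dwhite∣MW), (Jfac), (cJ-bdd∕Lip), (χ-read)} — the two χ-letters are GONE
in favour of one structure identity; `Kχ` extensive in `#S` (harmless: REG′ is qualitative — RULING №57).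

HONEST FRAMING: doors between HYPOTHESIS letters; (χ-read), (Dwhite∣MW), (Dmin), (Jfac), (cJ-bdd∕Lip) are D0's content (crux 19200 EX ∧ V2′) and NOT proved here; nothing of
Bałaban's analysis is asserted or proved; (I-curv), (I-cov), KER′ letters, rows v0.1–v0.4 UNDISCHARGED; the five registered stubs of `Lines/semiclassical_s2beta.lean`, crux 20520 and
`YM3TorusSU2` are NOT proved; registry untouched; rung R3 = SU(2) YM₃ on T³ — NOT d = 4, NOT infinite volume, NOT a mass gap, NOT Clay; the Yang–Mills mass gap is NOT proved.  [folklore]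
-/

set_option autoImplicit false

noncomputable section

namespace Summit.QuantumFields.YangMills.Theorems.OrganTangentChiOfReadDwhite

open Function Set Finset
open scoped NNReal BigOperators
open Literature.MathematicalPhysics.QuantumFieldTheory
open Literature.MathematicalPhysics.QuantumFieldTheory.Balaban1983to89 T3ContinuumYM3Torus T3NestedUnitLaws
  T3UnitLawDensityEML T4Continuum BalabanUVClass T3UnitScaleTilt T3LevelShift T3TiltDescent
open T4CubeChartExp (expPt toE)
open Summit.QuantumFields.YangMills.Theorems.OrganTangentHaarFactorLipOfDwhite (haarFactor_mem_Icc haarFactor_lip_of_dwhite)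
open Summit.QuantumFields.YangMills.Theorems.OrganTangentD0ChartLettersWhitened (jLipPath_of_factors jLipSquare_of_factors)

/-! ## §1 The two χ-letters of ✓(L50b) from (χ-read) + (Dwhite∣MW) -/

section Chi

/-- ★★ **(χ-bdd) FROM (χ-read)** — ✓(L50b)'s `hχbdd` binder text with `Cχ := 1`: a product of `sinc²` factors lies in `[0,1]` (px19 g23 ✓`haarFactor_mem_Icc`).
[cite: Balaban1985UV3, p.260 L25-31] -/
theorem chi_bdd_of_read (F : T3Family) (γ b₀ p₀ : ℝ) (j Ts : ℕ) {Z : Type}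
    (Wh : GaugeField (F.P j) 0 ↥(Matrix.specialUnitaryGroup (Fin 2) ℂ) → Z → PBond (F.P Ts) 0 → (Fin 3 → ℝ)) (χ : GaugeField (F.P j) 0 ↥(Matrix.specialUnitaryGroup (Fin 2) ℂ) → Z → ℝ) (S : Finset (PBond (F.P Ts) 0))
    (hχread : ∀ V z, χ V z = ∏ e ∈ S, Real.sinc ‖toE (Wh V z e)‖ ^ 2) :
    ∀ (V : GaugeField (F.P j) 0 ↥(Matrix.specialUnitaryGroup (Fin 2) ℂ)) (z : Z), PlaqSmall (θBal F.L γ b₀ p₀ j) V → |χ V z| ≤ 1 := by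
  intro V z _
  rw [hχread]
  have h := haarFactor_mem_Icc S (Wh V z)
  rw [abs_of_nonneg h.1]
  exact h.2

/-- ★★★ **(χ-Lip∣MW) FROM (χ-read) + (Dwhite∣MW)** — ✓(L50b)'s `hχLip` binder text with `Kχ := √3·Σ_{e∈S} kW e` (px19 g23 ✓`haarFactor_lip_of_dwhite` fed with the
(Dwhite∣MW) increments at `c = ‖u‖`). [cite: Balaban1985UV3, p.260 L25-31] -/
theorem chi_lip_of_read_dwhite (F : T3Family) (γ b₀ p₀ : ℝ) (j Ts : ℕ) {Z : Type}
    (Φ : GaugeField (F.P j) 0 ↥(Matrix.specialUnitaryGroup (Fin 2) ℂ) × Z → GaugeField (F.P Ts) 0 ↥(Matrix.specialUnitaryGroup (Fin 2) ℂ))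
    (Wh : GaugeField (F.P j) 0 ↥(Matrix.specialUnitaryGroup (Fin 2) ℂ) → Z → PBond (F.P Ts) 0 → (Fin 3 → ℝ)) (χ : GaugeField (F.P j) 0 ↥(Matrix.specialUnitaryGroup (Fin 2) ℂ) → Z → ℝ) (S : Finset (PBond (F.P Ts) 0))
    (hχread : ∀ V z, χ V z = ∏ e ∈ S, Real.sinc ‖toE (Wh V z e)‖ ^ 2) (δ₀ : ℝ) (kW : PBond (F.P Ts) 0 → ℝ)
    (hDwhite : ∀ (z : Z) (V : GaugeField (F.P j) 0 ↥(Matrix.specialUnitaryGroup (Fin 2) ℂ)) (b : PBond (F.P j) 0) (u : Fin 3 → ℝ), PlaqSmall (θBal F.L γ b₀ p₀ j) V →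
      PlaqSmall (θBal F.L γ b₀ p₀ j) (update V b (V b * expPt u)) → ‖u‖ ≤ δ₀ →
      (∀ r ∈ Set.Ioo (0:ℝ) 1, ∀ (n : ℕ) (hjn : j + 1 ≤ n) (hnK : n ≤ Ts), PlaqSmall (24 / 25 * θBal F.L γ b₀ p₀ n) (descendTo F ℰp n Ts hnK (Φ (update V b (V b * expPt (r • u)), z)))) →
      ∀ e, ‖Wh (update V b (V b * expPt u)) z e - Wh V z e‖ ≤ kW e * ‖u‖) :
    ∀ (z : Z) (V : GaugeField (F.P j) 0 ↥(Matrix.specialUnitaryGroup (Fin 2) ℂ)) (b : PBond (F.P j) 0) (u : Fin 3 → ℝ), PlaqSmall (θBal F.L γ b₀ p₀ j) V →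
      PlaqSmall (θBal F.L γ b₀ p₀ j) (update V b (V b * expPt u)) → ‖u‖ ≤ δ₀ →
      (∀ r ∈ Set.Ioo (0:ℝ) 1, ∀ (n : ℕ) (hjn : j + 1 ≤ n) (hnK : n ≤ Ts), PlaqSmall (24 / 25 * θBal F.L γ b₀ p₀ n) (descendTo F ℰp n Ts hnK (Φ (update V b (V b * expPt (r • u)), z)))) →
      |χ (update V b (V b * expPt u)) z - χ V z| ≤ (Real.sqrt 3 * ∑ e ∈ S, kW e) * ‖u‖ := by
  intro z V b u hV hV' hu hMW
  rw [hχread, hχread]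
  exact haarFactor_lip_of_dwhite S (Wh V z) (Wh (update V b (V b * expPt u)) z) kW fun e _ => hDwhite z V b u hV hV' hu hMW e

end Chi

/-! ## §2 The (J-Lip)∣MW binders of ✓p823910 END TO END from (Jfac) + (cJ-bdd∕Lip) + (χ-read) + (Dwhite∣MW) -/

section Jacobian

/-- ★★★ **(J-Lip)∣MW ALONG NEAR RELATIONAL PATHS FROM (Jfac) + (cJ-bdd∕Lip) + (χ-read) + (Dwhite∣MW)** — ✓p823910's `hPJ` binder text with
`KJ := toNNReal ((Cc·(√3·Σ_{e∈S} kW e) + 1·Kc)·(√3·(rc·(θ_j∕4))))` (✓`jLipPath_of_factors` ∘ §1). [cite: Balaban1985UV3, p.260 L25-31] -/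
theorem jLipPath_of_cJ_chiRead_dwhite (F : T3Family) (γ b₀ p₀ : ℝ) (j Ts : ℕ) {Z : Type}
    (Φ : GaugeField (F.P j) 0 ↥(Matrix.specialUnitaryGroup (Fin 2) ℂ) × Z → GaugeField (F.P Ts) 0 ↥(Matrix.specialUnitaryGroup (Fin 2) ℂ)) (J : GaugeField (F.P j) 0 ↥(Matrix.specialUnitaryGroup (Fin 2) ℂ) × Z → ℝ≥0) (cJ : GaugeField (F.P j) 0 ↥(Matrix.specialUnitaryGroup (Fin 2) ℂ) → ℝ) (χ : GaugeField (F.P j) 0 ↥(Matrix.specialUnitaryGroup (Fin 2) ℂ) → Z → ℝ)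
    (hJfac : ∀ V z, (J (V, z) : ℝ) = cJ V * χ V z)
    (Wh : GaugeField (F.P j) 0 ↥(Matrix.specialUnitaryGroup (Fin 2) ℂ) → Z → PBond (F.P Ts) 0 → (Fin 3 → ℝ)) (S : Finset (PBond (F.P Ts) 0))
    (hχread : ∀ V z, χ V z = ∏ e ∈ S, Real.sinc ‖toE (Wh V z e)‖ ^ 2)
    (rc δ δ₀ : ℝ) (hrc : 0 ≤ rc) (hδpos : 0 < δ) (hθj : 0 < θBal F.L γ b₀ p₀ j) (hguard : (1 + 16 * Real.sqrt 3 * rc) * (θBal F.L γ b₀ p₀ j / 4) ≤ θBal F.L γ b₀ p₀ j)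
    (hδ₀ : Real.sqrt 3 * (δ * (rc * (θBal F.L γ b₀ p₀ j / 4))) ≤ δ₀)
    (Cc Kc : ℝ) (hCc : 0 ≤ Cc) (hKc : 0 ≤ Kc) (kW : PBond (F.P Ts) 0 → ℝ) (hkW0 : ∀ e, 0 ≤ kW e)
    (hcbdd : ∀ V : GaugeField (F.P j) 0 ↥(Matrix.specialUnitaryGroup (Fin 2) ℂ), PlaqSmall (θBal F.L γ b₀ p₀ j) V → |cJ V| ≤ Cc)
    (hcLip : ∀ (V : GaugeField (F.P j) 0 ↥(Matrix.specialUnitaryGroup (Fin 2) ℂ)) (b : PBond (F.P j) 0) (u : Fin 3 → ℝ), PlaqSmall (θBal F.L γ b₀ p₀ j) V →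
      PlaqSmall (θBal F.L γ b₀ p₀ j) (update V b (V b * expPt u)) → ‖u‖ ≤ δ₀ → |cJ (update V b (V b * expPt u)) - cJ V| ≤ Kc * ‖u‖)
    (hDwhite : ∀ (z : Z) (V : GaugeField (F.P j) 0 ↥(Matrix.specialUnitaryGroup (Fin 2) ℂ)) (b : PBond (F.P j) 0) (u : Fin 3 → ℝ), PlaqSmall (θBal F.L γ b₀ p₀ j) V →
      PlaqSmall (θBal F.L γ b₀ p₀ j) (update V b (V b * expPt u)) → ‖u‖ ≤ δ₀ →
      (∀ r ∈ Set.Ioo (0:ℝ) 1, ∀ (n : ℕ) (hjn : j + 1 ≤ n) (hnK : n ≤ Ts), PlaqSmall (24 / 25 * θBal F.L γ b₀ p₀ n) (descendTo F ℰp n Ts hnK (Φ (update V b (V b * expPt (r • u)), z)))) →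
      ∀ e, ‖Wh (update V b (V b * expPt u)) z e - Wh V z e‖ ≤ kW e * ‖u‖) :
    ∀ (B' : PBond (F.P j) 0) (m' : Fin 3 → ℝ) (U₂ : GaugeField (F.P j) 0 ↥(Matrix.specialUnitaryGroup (Fin 2) ℂ))
      (X : ℝ → GaugeField (F.P j) 0 ↥(Matrix.specialUnitaryGroup (Fin 2) ℂ)), ‖m'‖ ≤ rc * (θBal F.L γ b₀ p₀ j / 4) → PlaqSmall (θBal F.L γ b₀ p₀ j / 4) U₂ →
      (∀ s e, e ≠ B' → X s e = U₂ e) → (∀ s, X s B' = U₂ B' * expPt (s • m')) → ∀ (z : Z), ∀ x ∈ Set.Ioo (-1 : ℝ) 2, ∀ y ∈ Set.Ioo (-1 : ℝ) 2,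
        (∀ r ∈ Set.uIoo x y, ∀ (n : ℕ) (hjn : j + 1 ≤ n) (hnK : n ≤ Ts), PlaqSmall (24 / 25 * θBal F.L γ b₀ p₀ n) (descendTo F ℰp n Ts hnK (Φ (X r, z)))) →
        LipschitzOnWith (Real.toNNReal ((Cc * (Real.sqrt 3 * ∑ e ∈ S, kW e) + 1 * Kc) * (Real.sqrt 3 * (rc * (θBal F.L γ b₀ p₀ j / 4))))) (fun s => (J (X s, z) : ℝ)) (Set.Ioo (-1 : ℝ) 2 ∩ Set.uIcc x y) :=
  jLipPath_of_factors F γ b₀ p₀ j Ts Φ J cJ χ hJfac rc δ δ₀ hrc hδpos hθj hguard hδ₀ Cc Kc 1 (Real.sqrt 3 * ∑ e ∈ S, kW e) hCc hKc zero_le_one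
    (mul_nonneg (Real.sqrt_nonneg 3) (Finset.sum_nonneg fun e _ => hkW0 e)) hcbdd hcLip
    (chi_bdd_of_read F γ b₀ p₀ j Ts Wh χ S hχread) (chi_lip_of_read_dwhite F γ b₀ p₀ j Ts Φ Wh χ S hχread δ₀ kW hDwhite)

/-- ★★★ **THE SAME ALONG THE ROWS OF NEAR RELATIONAL SQUARES** — ✓p823910's `hSJ` binder text, same `KJ` (✓`jLipSquare_of_factors` ∘ §1). [cite: Balaban1985UV3, p.260 L25-31] -/
theorem jLipSquare_of_cJ_chiRead_dwhite (F : T3Family) (γ b₀ p₀ : ℝ) (j Ts : ℕ) {Z : Type}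
    (Φ : GaugeField (F.P j) 0 ↥(Matrix.specialUnitaryGroup (Fin 2) ℂ) × Z → GaugeField (F.P Ts) 0 ↥(Matrix.specialUnitaryGroup (Fin 2) ℂ)) (J : GaugeField (F.P j) 0 ↥(Matrix.specialUnitaryGroup (Fin 2) ℂ) × Z → ℝ≥0) (cJ : GaugeField (F.P j) 0 ↥(Matrix.specialUnitaryGroup (Fin 2) ℂ) → ℝ) (χ : GaugeField (F.P j) 0 ↥(Matrix.specialUnitaryGroup (Fin 2) ℂ) → Z → ℝ)
    (hJfac : ∀ V z, (J (V, z) : ℝ) = cJ V * χ V z)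
    (Wh : GaugeField (F.P j) 0 ↥(Matrix.specialUnitaryGroup (Fin 2) ℂ) → Z → PBond (F.P Ts) 0 → (Fin 3 → ℝ)) (S : Finset (PBond (F.P Ts) 0))
    (hχread : ∀ V z, χ V z = ∏ e ∈ S, Real.sinc ‖toE (Wh V z e)‖ ^ 2)
    (rc δ δ₀ : ℝ) (hrc : 0 ≤ rc) (hδpos : 0 < δ) (hθj : 0 < θBal F.L γ b₀ p₀ j) (hguard : (1 + 16 * Real.sqrt 3 * rc) * (θBal F.L γ b₀ p₀ j / 4) ≤ θBal F.L γ b₀ p₀ j)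
    (hδ₀ : Real.sqrt 3 * (δ * (rc * (θBal F.L γ b₀ p₀ j / 4))) ≤ δ₀)
    (Cc Kc : ℝ) (hCc : 0 ≤ Cc) (hKc : 0 ≤ Kc) (kW : PBond (F.P Ts) 0 → ℝ) (hkW0 : ∀ e, 0 ≤ kW e)
    (hcbdd : ∀ V : GaugeField (F.P j) 0 ↥(Matrix.specialUnitaryGroup (Fin 2) ℂ), PlaqSmall (θBal F.L γ b₀ p₀ j) V → |cJ V| ≤ Cc)
    (hcLip : ∀ (V : GaugeField (F.P j) 0 ↥(Matrix.specialUnitaryGroup (Fin 2) ℂ)) (b : PBond (F.P j) 0) (u : Fin 3 → ℝ), PlaqSmall (θBal F.L γ b₀ p₀ j) V →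
      PlaqSmall (θBal F.L γ b₀ p₀ j) (update V b (V b * expPt u)) → ‖u‖ ≤ δ₀ → |cJ (update V b (V b * expPt u)) - cJ V| ≤ Kc * ‖u‖)
    (hDwhite : ∀ (z : Z) (V : GaugeField (F.P j) 0 ↥(Matrix.specialUnitaryGroup (Fin 2) ℂ)) (b : PBond (F.P j) 0) (u : Fin 3 → ℝ), PlaqSmall (θBal F.L γ b₀ p₀ j) V →
      PlaqSmall (θBal F.L γ b₀ p₀ j) (update V b (V b * expPt u)) → ‖u‖ ≤ δ₀ →
      (∀ r ∈ Set.Ioo (0:ℝ) 1, ∀ (n : ℕ) (hjn : j + 1 ≤ n) (hnK : n ≤ Ts), PlaqSmall (24 / 25 * θBal F.L γ b₀ p₀ n) (descendTo F ℰp n Ts hnK (Φ (update V b (V b * expPt (r • u)), z)))) →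
      ∀ e, ‖Wh (update V b (V b * expPt u)) z e - Wh V z e‖ ≤ kW e * ‖u‖) :
    ∀ (B B' : PBond (F.P j) 0) (m m' : Fin 3 → ℝ) (V00 : GaugeField (F.P j) 0 ↥(Matrix.specialUnitaryGroup (Fin 2) ℂ))
      (Y : ℝ → GaugeField (F.P j) 0 ↥(Matrix.specialUnitaryGroup (Fin 2) ℂ)) (X : ℝ → ℝ → GaugeField (F.P j) 0 ↥(Matrix.specialUnitaryGroup (Fin 2) ℂ)),
      ‖m‖ ≤ rc * (θBal F.L γ b₀ p₀ j / 4) → ‖m'‖ ≤ rc * (θBal F.L γ b₀ p₀ j / 4) → PlaqSmall (θBal F.L γ b₀ p₀ j / 4) V00 →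
      (∀ s e, e ≠ B → Y s e = V00 e) → (∀ s, Y s B = V00 B * expPt (s • m)) → (∀ s s' e, e ≠ B' → X s s' e = Y s e) → (∀ s s', X s s' B' = Y s B' * expPt (s' • m')) →
      ∀ s' ∈ Set.Icc (0:ℝ) 1, ∀ (z : Z), ∀ x ∈ Set.Ioo (-1 : ℝ) 2, ∀ y ∈ Set.Ioo (-1 : ℝ) 2,
        (∀ r ∈ Set.uIoo x y, ∀ (n : ℕ) (hjn : j + 1 ≤ n) (hnK : n ≤ Ts), PlaqSmall (24 / 25 * θBal F.L γ b₀ p₀ n) (descendTo F ℰp n Ts hnK (Φ (X r s', z)))) →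
        LipschitzOnWith (Real.toNNReal ((Cc * (Real.sqrt 3 * ∑ e ∈ S, kW e) + 1 * Kc) * (Real.sqrt 3 * (rc * (θBal F.L γ b₀ p₀ j / 4))))) (fun s => (J (X s s', z) : ℝ)) (Set.Ioo (-1 : ℝ) 2 ∩ Set.uIcc x y) :=
  jLipSquare_of_factors F γ b₀ p₀ j Ts Φ J cJ χ hJfac rc δ δ₀ hrc hδpos hθj hguard hδ₀ Cc Kc 1 (Real.sqrt 3 * ∑ e ∈ S, kW e) hCc hKc zero_le_one
    (mul_nonneg (Real.sqrt_nonneg 3) (Finset.sum_nonneg fun e _ => hkW0 e)) hcbdd hcLip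
    (chi_bdd_of_read F γ b₀ p₀ j Ts Wh χ S hχread) (chi_lip_of_read_dwhite F γ b₀ p₀ j Ts Φ Wh χ S hχread δ₀ kW hDwhite)

end Jacobian

end Summit.QuantumFields.YangMills.Theorems.OrganTangentChiOfReadDwhite

end
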